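import Literature.Barriers.Schanuel.AxiomsDoNotForceSchanuel
import Literature.NumberTheory.Transcendental.GammaFields
import HarnessLib

/-!
# Named fact: Bays–Kirby's quasiminimal fields `𝔹_P` — Schanuel counterexamples confined to
# `span_ℚ(1, τ)`, the Schanuel property holding OVER it (Bays–Kirby 2018, §9.2)

M. Bays, J. Kirby, *Pseudo-exponential maps, variants, and quasiminimality*, Algebra & Number
Theory **12** (2018) 493–549 (doi:10.2140/ant.2018.12.493 = arXiv:1512.04262v4), §9.2
«Incorporating a counterexample to Schanuel's conjecture» (arXiv p. 28; held as
`paper:arxiv-1512.04262`, p0028 L37–L41, read on the page).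

## What the source prints (verbatim)

* "we choose an irreducible polynomial `P(x, y) ∈ ℤ[x, y]` and take `(ε, τ)` to be a generic zero
  of the polynomial `P(x, y)`. (We assume that `P` is such that neither `ε` nor `τ` is zero.) …
  define `Γ(K)` to be the graph of a homomorphism from the `ℚ`-linear span of `τ` and `1`, with
  `τ/m ↦ ω_m` as above and `1/m ↦ ε_m`."
* "Now the construction gives us a canonical model `𝔹_P`, the unique model of cardinality
  continuum of almost the same list of axioms as those for `𝔹`, except that Schanuel's conjecture
  has this exception with the formal analogues `ε` and `τ` of `e` and `2πi` being algebraically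
  dependent via the polynomial `P`. **More precisely, the predimension axiom is replaced by an
  axiom scheme stating that `exp(1)` and `τ` are transcendental, that `P(exp(1), τ) = 0`, and the
  condition that for all tuples `ā`, `td(ā, exp(ā)/τ, exp(1)) − ldim_ℚ(ā/τ, 1) ≥ 0`.**"
* "More generally, we can take any finitely generated partial exponential field with standard
  kernel (that is, a finitely generated Γ-field for the appropriate groups and kernels) as
  `F_base` and do the same construction to build a quasiminimal exponential field `𝕄(F_base)` of
  size continuum with counterexamples to the Schanuel property within a finite-dimensional
  `ℚ`-vector space, but with the Schanuel property holding over that vector space. Each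
  `𝕄(F_base)` is unique up to isomorphism as a model of appropriate axioms, just as `𝔹` is."
  (The axioms for `𝔹`: Thm 9.1 — 1 ELA-field, 2 standard kernel, 3 Schanuel property, 4 strong
  exponential-algebraic closedness, 5 countable closure property; `𝔹` is quasiminimal, Thm 1.2.)

## Relation to the tree

The barrier file `Literature/Barriers/Schanuel/AxiomsDoNotForceSchanuel.lean` already carries the
named fact `Literature.Barriers.Schanuel.baysKirby2018_modelsWithoutSchanuel`: for every admissible
`P` (`IsAdmissibleRelation P`: irreducible of positive degree in each variable) an exponential
field `𝔹_P` of cardinality `𝔠`, ELA, standard kernel `τℤ` with `τ` transcendental, `exp 1`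
transcendental, `P(exp 1, τ) = 0`, Kirby's scheme (axiom 4), CCP, quasiminimal. It OMITS the last
clause of the replaced axiom scheme — the Schanuel property RELATIVE to `span_ℚ(1, τ)`. In the
vocabulary of `Literature/NumberTheory/Transcendental/GammaFields.lean` (Bays–Kirby §§3–4 inside a
fixed exponential field: `GammaField.predim Λ Λ' = td(Λ', exp Λ'/ℚ(Λ, exp Λ)) − ldim_ℚ(Λ'/Λ)`,
`GammaField.IsStrong Λ` ⟺ `δ(ā/Λ) ≥ 0` for every finite tuple, `GammaField.isStrong_iff_finset`)
that clause is exactly `GammaField.IsStrong (span_ℚ {1, τ})`: since `exp τ = 1` and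
`exp(q + rτ) = exp(1)^q` is algebraic over `exp 1` for `q, r ∈ ℚ`, the field `ℚ(V, exp V)`,
`V = span_ℚ(1, τ)`, is algebraic over `ℚ(τ, exp 1)`, so `td(ā, exp ā/ℚ(V, exp V)) =
td(ā, exp(ā)/τ, exp(1))`, and `ldim_ℚ(span ā/V) = ldim_ℚ(ā/τ, 1)`. (By contrast the Schanuel
property itself is `GammaField.IsStrong ⊥`, `schanuelProperty_iff_isStrong_bot`, equivalently
`IsStrong (span_ℚ {τ})`, `schanuelProperty_iff_isStrong_span_kernelGenerator` — and FAILS in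
`𝔹_P`, `Literature.Barriers.Schanuel.not_schanuelProperty_of_kernel_relation`.)

## Contents

* `baysKirby2018_modelsRelativeSchanuel` — the NAMED FACT (this file's only one): the barrier
  file's statement with the relative-Schanuel clause `GammaField.IsStrong (span_ℚ {1, τ})` added
  inside the kernel-generator block. Special case `F_base` = the §9.2 base (so `V = span_ℚ(1, τ)`,
  `dim V = 2`) of the printed "more generally" paragraph.
  -- TODO(general form): for every finitely generated partial exponential field `F_base` with
  -- standard kernel (`IsStdKernelPartialExpField`, `PseudoExpVariants.lean`) a quasiminimal
  -- `𝕄(F_base)` of size `𝔠` into which `F_base` embeds STRONGLY; not vendored (its "appropriate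
  -- axioms" are Thm 8.2's, carried as a hypothesis in `AxiomsDoNotForceSchanuelProofs.lean`).
* PROVED from it: `….modelsWithoutSchanuel` (it implies the barrier file's fact, so every user of
  `(h : baysKirby2018_modelsWithoutSchanuel)` is served), `….isStrong_iff_printed` (the clause
  unfolds to the printed axiom scheme), and (private helpers `exp τ = 1`, `finrank_ℚ V = 2` aside)
  the SEPARATION WITNESS
  `….exists_isStrong_finrank_two_not_schanuelProperty`: a quasiminimal ELA-field of cardinality
  `𝔠` with standard kernel, Kirby's scheme and CCP, and a `ℚ`-subspace `V` with `finrank_ℚ V = 2`,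
  `V ◁ F` (Schanuel over `V`) but NOT the Schanuel property (`= ¬ (0 ◁ F)` by
  `schanuelProperty_iff_isStrong_bot`) — witnessed inside `V` by the `ℚ`-linearly independent
  pair `(1, τ)` with `td ℚ(1, τ, exp 1, exp τ) < 2`.

Uniqueness/categoricity of `𝔹_P` ("the unique model of cardinality continuum") is recorded in
prose only, as in the barrier file. No `sorry`; one new named fact (a `cite` item of THE PASS,
requested by route `route-Schanuel-RootDecomp1`, item `stmt-Schanuel-24394`, as its BC5/T3
separation witness); nothing else unproved.
-/

noncomputable section

open Cardinal
open Literature.ModelTheory.ExponentialFields Literature.ModelTheory.ExponentialFields.ExponentialRing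
open Literature.Barriers.Schanuel (IsAdmissibleRelation baysKirby2018_modelsWithoutSchanuel
  isAdmissibleRelation_X_sub_X not_schanuelProperty_of_kernel_relation linearIndependent_one_tau)

namespace Literature.NumberTheory.Transcendental

open GammaField

/-- **Bays–Kirby 2018, §9.2: the pseudo-exponential fields `𝔹_P` — a counterexample to the
Schanuel property inside `span_ℚ(1, τ)`, the Schanuel property holding over `span_ℚ(1, τ)`.**
For every admissible `P ∈ ℤ[x, y]` (irreducible, of positive degree in each variable) there is an
exponential field `F = 𝔹_P` of cardinality continuum which is an ELA-field (algebraically closed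
of characteristic zero, `exp` surjective onto `Fˣ`) with standard kernel `ker exp = τℤ`, `τ`
transcendental, in which `exp 1` is transcendental, `P(exp 1, τ) = 0`, and **for all tuples `ā`,
`td(ā, exp(ā)/τ, exp(1)) − ldim_ℚ(ā/τ, 1) ≥ 0`** — i.e. the Γ-subfield of `V = span_ℚ {1, τ}` is
strong in `F`, `GammaField.IsStrong V` (`isStrong_iff_finset`) — satisfying moreover strong
exponential-algebraic closedness in Kirby's "`ℚ`-linearly independent over `ā`" form, the
countable closure property, and quasiminimality. (Printed: "the predimension axiom is replaced by
an axiom scheme stating that `exp(1)` and `τ` are transcendental, that `P(exp(1), τ) = 0`, and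
the condition that for all tuples `ā`, `td(ā, exp(ā)/τ, exp(1)) − ldim_ℚ(ā/τ, 1) ≥ 0`"; "a
quasiminimal exponential field … of size continuum with counterexamples to the Schanuel property
within a finite-dimensional `ℚ`-vector space, but with the Schanuel property holding over that
vector space".) Named fact — the construction is §§3–8 of the paper (Thm 1.7, Thm 8.2) over the
§9.2 base; users take `(h : baysKirby2018_modelsRelativeSchanuel)`; it implies the barrier file's
`baysKirby2018_modelsWithoutSchanuel` (`baysKirby2018_modelsRelativeSchanuel.modelsWithoutSchanuel`).
[cite: BaysKirby2018ANT, §9.2 (with Thm 1.7, Thm 8.2, Thm 9.1)] -/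
def baysKirby2018_modelsRelativeSchanuel : Prop :=
  ∀ P : MvPolynomial (Fin 2) ℤ, IsAdmissibleRelation P →
    ∃ (F : Type) (_ : Field F) (_ : CharZero F) (_ : ExponentialRing F),
      #F = 𝔠 ∧ IsAlgClosed F ∧ IsSurjectiveOntoUnits F ∧
      (∃ τ : F, Transcendental ℚ τ ∧ expKernel F = AddSubgroup.zmultiples τ ∧
        Transcendental ℚ (exp (1 : F)) ∧ MvPolynomial.aeval ![exp (1 : F), τ] P = 0 ∧
        GammaField.IsStrong (Submodule.span ℚ ({1, τ} : Set F))) ∧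
      IsLinIndepExpAlgClosed F ∧ HasCountableClosureProperty F ∧
      Language.expRing.IsQuasiminimal F

/-! ### Proved consequences -/

/-- The relative clause unfolds to the printed axiom scheme: `V ◁ F` for `V = span_ℚ {1, τ}` iff
`δ(ā/V) = td(ā, exp ā/ℚ(V, exp V)) − ldim_ℚ(span ā/V) ≥ 0` for every finite tuple `ā`
(`GammaField.isStrong_iff_finset`). [cite: BaysKirby2018ANT, §9.2 and Def. 4.3] -/
theorem baysKirby2018_modelsRelativeSchanuel.isStrong_iff_printed
    {F : Type*} [Field F] [CharZero F] [ExponentialRing F] (τ : F) :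
    GammaField.IsStrong (Submodule.span ℚ ({1, τ} : Set F)) ↔
      ∀ s : Finset F, 0 ≤ GammaField.predim (Submodule.span ℚ ({1, τ} : Set F))
        (Submodule.span ℚ (s : Set F)) :=
  GammaField.isStrong_iff_finset

/-- **The new fact implies the barrier file's fact** (drop the relative-Schanuel clause), so
`(h : baysKirby2018_modelsWithoutSchanuel)`-users are fed from it. [cite: BaysKirby2018ANT, §9.2] -/
theorem baysKirby2018_modelsRelativeSchanuel.modelsWithoutSchanuel
    (h : baysKirby2018_modelsRelativeSchanuel) : baysKirby2018_modelsWithoutSchanuel := by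
  intro P hP
  obtain ⟨F, _, _, _, hcard, hac, hsurj, ⟨τ, hτ, hker, he, hrel, -⟩, hlin, hccp, hqm⟩ := h P hP
  exact ⟨F, inferInstance, inferInstance, inferInstance, hcard, hac, hsurj,
    ⟨τ, hτ, hker, he, hrel⟩, hlin, hccp, hqm⟩

/-- In a field as in the fact the kernel generator satisfies `exp τ = 1`. [folklore] -/
private theorem exp_eq_one_of_expKernel_eq_zmultiples {F : Type*} [Field F] [CharZero F]
    [ExponentialRing F] {τ : F} (hker : expKernel F = AddSubgroup.zmultiples τ) : exp τ = 1 := by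
  rw [← mem_expKernel_iff, hker]
  exact AddSubgroup.mem_zmultiples τ

/-- `span_ℚ {1, τ}` has `ℚ`-dimension `2` when `τ` is transcendental. [folklore] -/
private theorem finrank_span_one_tau {F : Type*} [Field F] [CharZero F] {τ : F}
    (hτ : Transcendental ℚ τ) :
    Module.finrank ℚ (Submodule.span ℚ ({1, τ} : Set F)) = 2 := by
  have hli : LinearIndependent ℚ ![(1 : F), τ] := linearIndependent_one_tau hτ
  have hrange : Set.range ![(1 : F), τ] = {1, τ} := by
    ext x
    simp only [Set.mem_range, Set.mem_insert_iff, Set.mem_singleton_iff]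
    constructor
    · rintro ⟨i, rfl⟩
      rcases Fin.exists_fin_two.mp ⟨i, rfl⟩ with h | h
      · exact Or.inl (by rw [h]; rfl)
      · exact Or.inr (by rw [h]; rfl)
    · rintro (rfl | rfl)
      exacts [⟨0, rfl⟩, ⟨1, rfl⟩]
  rw [← hrange, finrank_span_eq_card hli]
  simp

/-- **SEPARATION WITNESS (Schanuel over a plane, not over `0`).** From the fact, with the
admissible `P = x − y` (so `exp 1 = τ`): a quasiminimal ELA-field `F` of cardinality `𝔠` with
standard kernel `τℤ`, Kirby's scheme and the countable closure property, together with the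
`ℚ`-subspace `V = span_ℚ {1, τ}` of dimension `2` such that `V ◁ F` (the Schanuel property holds
OVER `V`: `δ(ā/V) ≥ 0` for all `ā`) while the Schanuel property FAILS (equivalently `¬ (0 ◁ F)`,
`schanuelProperty_iff_isStrong_bot` of `ZilberFieldExistenceProofs.lean`), and fails inside `V`:
`(1, τ)` is `ℚ`-linearly independent with `td_ℚ ℚ(1, τ, exp 1, exp τ) < 2`.
[cite: BaysKirby2018ANT, §9.2] -/
theorem baysKirby2018_modelsRelativeSchanuel.exists_isStrong_finrank_two_not_schanuelProperty
    (h : baysKirby2018_modelsRelativeSchanuel) :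
    ∃ (F : Type) (_ : Field F) (_ : CharZero F) (_ : ExponentialRing F) (τ : F),
      #F = 𝔠 ∧ IsAlgClosed F ∧ IsSurjectiveOntoUnits F ∧
      Transcendental ℚ τ ∧ expKernel F = AddSubgroup.zmultiples τ ∧
      IsLinIndepExpAlgClosed F ∧ HasCountableClosureProperty F ∧
      Language.expRing.IsQuasiminimal F ∧
      Module.finrank ℚ (Submodule.span ℚ ({1, τ} : Set F)) = 2 ∧
      GammaField.IsStrong (Submodule.span ℚ ({1, τ} : Set F)) ∧
      ¬ SchanuelProperty F ∧
      (LinearIndependent ℚ ![(1 : F), τ] ∧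
        Algebra.trdeg ℚ ↥(IntermediateField.adjoin ℚ
          (Set.range ![(1 : F), τ] ∪ Set.range (exp ∘ ![(1 : F), τ]))) < (2 : ℕ)) := by
  obtain ⟨F, _, _, _, hcard, hac, hsurj, ⟨τ, hτ, hker, -, hrel, hstrong⟩, hlin, hccp, hqm⟩ :=
    h _ isAdmissibleRelation_X_sub_X
  have hτker : exp τ = 1 := exp_eq_one_of_expKernel_eq_zmultiples hker
  have hSP : ¬ SchanuelProperty F :=
    not_schanuelProperty_of_kernel_relation hτ hτker isAdmissibleRelation_X_sub_X.1.ne_zero hrel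
  have hli : LinearIndependent ℚ ![(1 : F), τ] := linearIndependent_one_tau hτ
  refine ⟨F, inferInstance, inferInstance, inferInstance, τ, hcard, hac, hsurj, hτ, hker, hlin,
    hccp, hqm, finrank_span_one_tau hτ, hstrong, hSP, hli, ?_⟩
  -- the Schanuel inequality fails at the tuple `(1, τ)` itself: `ℚ(1, τ, exp 1, exp τ) = ℚ(τ)`
  have he1 : exp (1 : F) = τ := by
    have h0 := hrel
    simp only [map_sub, MvPolynomial.aeval_X, Matrix.cons_val_zero, Matrix.cons_val_one] at h0
    exact sub_eq_zero.mp h0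
  have hT : Set.range ![(1 : F), τ] ∪ Set.range (exp ∘ ![(1 : F), τ]) = {1, τ} := by
    ext x
    simp only [Matrix.range_cons, Matrix.range_empty, Set.union_empty, Set.union_singleton,
      Set.range_comp, Set.image_insert_eq, Set.image_singleton, he1, hτker, Set.mem_union,
      Set.mem_insert_iff, Set.mem_singleton_iff]
    tauto
  have hKeq : IntermediateField.adjoin ℚ (Set.range ![(1 : F), τ] ∪ Set.range (exp ∘ ![(1 : F), τ]))
      = IntermediateField.adjoin ℚ ({τ} : Set F) := by
    rw [hT]
    refine le_antisymm ?_ (IntermediateField.adjoin.mono _ _ _ (by simp))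
    rw [IntermediateField.adjoin_le_iff]
    rintro x (rfl | rfl)
    · exact one_mem _
    · exact IntermediateField.subset_adjoin ℚ ({x} : Set F) rfl
  rw [hKeq]
  have htr : Algebra.trdeg ℚ ↥(IntermediateField.adjoin ℚ ({τ} : Set F)) ≤ 1 := by
    have halg := isAlgebraic_adjoin_over_algebraAdjoin (F := ℚ) ({τ} : Set F)
    refine (Algebra.IsAlgebraic.trdeg_le_cardinalMk (alg := halg)).trans ?_
    refine (Cardinal.mk_preimage_of_injective _ _ Subtype.val_injective).trans ?_
    simp
  calc Algebra.trdeg ℚ ↥(IntermediateField.adjoin ℚ ({τ} : Set F)) ≤ 1 := htr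
    _ < (2 : ℕ) := by norm_num

end Literature.NumberTheory.Transcendental

end
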